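import Literature.Probability.Percolation.IntRawGood
import Literature.Probability.Percolation.IntFrameBelow
import HarnessLib

/-!
# Raw success of a term explored FROM ABOVE at an internal extremity (twin of `ArmSeparationRawGoodUp.lean`, deterministic part)

Topic `Literature/Probability/Percolation`; family `crit-perc` / near-critical percolation on `𝕋`.
A brick of the INNER half of the near-critical arm-separation theorem for four arms in the ADJACENT
colour arrangement (P. Nolin, EJP 13 (2008), Thm. 11, `j = 4`, `σ = BBWW` [arXiv 0711.4948:
Thm. 10], §4.4 Lemma 15, internal extremities): the raw success event of the fence of a term of the
exploration of the inner half-annulus FROM ABOVE (`(intDom m).flip`) and its deterministic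
consequences, the twin of `TrapRawOKUp`:

* `IntRawOKUp m d z k ω` — some configuration agreeing with `ω` off `flip.lower d z` lies in
  `trapRSW₃ z k`;
* `IntRawOKUp.exists_fence_below_gen` (`int_exists_fence_below_gen`), `IntRawOKUp.outer_ring`,
  `IntRawOKUp.inner_ring`, `IntRawOKUp.not_pathIn_of_subset`, `IntRawOKUp.no_escape_below`
  (`int_no_closed_escape_below`);
* `IntSeqFailRawUp m u k₀ K`, `intNoRSWL_of_failRawUp`, `exists_intRawOKUp_of_not_fail`.

The probability of raw failure from above (the twin of `real_trapSeqFailRawUp_le_at`) is left to the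
probabilistic part of the inner half.

Everything here is proved; no named facts are introduced.

## References

* P. Nolin, Near-critical percolation in two dimensions, *Electron. J. Probab.* 13 (2008), §4.4
  Lemma 15 (proof), internal extremities (arXiv 0711.4948: Lemma 14; Thm. 10 p. 13) [Nolin2008].
* H. Kesten, Scaling relations for 2D-percolation, *Comm. Math. Phys.* 109 (1987), Lemma 2 [Kesten1987].
-/

noncomputable section

open Set

namespace Literature.Probability.Percolation

open LatticeModels HalfAnnulus

/-- **Raw success of the fence of a term `d` of the inner exploration from above (tip `z`) at scale
`k`.** [cite: Nolin2008, §4.4 Lemma 15 (proof), internal extremities (arXiv 0711.4948: Lemma 14)] -/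
def IntRawOKUp (m : ℕ) (d : Finset (Site 2)) (z : Site 2) (k : ℕ) (ω : SiteConfig (Site 2)) : Prop :=
  ∃ ω' : SiteConfig (Site 2), (∀ v, v ∉ (intDom m).flip.lower d z → (v ∈ ω' ↔ v ∈ ω)) ∧ ω' ∈ trapRSW₃ z k

namespace IntRawOKUp

variable {m k : ℕ} {d : Finset (Site 2)} {z : Site 2} {ω : SiteConfig (Site 2)}

/-- **The mirrored inner fence with a stopping set** from raw success. [cite: Nolin2008, §4.4 Lemma 15 (proof), internal extremities (arXiv 0711.4948: Lemma 14)] [cite: Kesten1987, Lemma 2] -/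
theorem exists_fence_below_gen (h : IntRawOKUp m d z k ω) (hm : 5 ≤ m) (hk : 1 ≤ k) (hd : (intDom m).flip.IsCrossing d z)
    (htk : -(m : ℤ) + 2 * k + 1 ≤ z 1 ∧ z 1 ≤ -(2 * (k : ℤ) + 1)) {S : Set (Site 2)} (hdS : (↑d : Set (Site 2)) ⊆ S)
    (hSn : ∀ v ∈ S, (m : ℤ) ≤ triNorm v) :
    ∃ mm : Site 2, OpenVCrossThrough (triStrip (z 0 - 2 * k) (z 1 - 2 * k) k k) (z 1 - 2 * k) (z 1 - k) ω mm ∧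
      ∃ q ∈ S, ∃ p : Site 2, triGraph.Adj q p ∧
        PathIn triGraph ((intFrameZoneBelow m z k ∩
          {v | ((m : ℤ) ≤ triNorm v → v ∈ (intDom m).flip.above d z) ∧ (triNorm v < m → v 1 < z 1)}) ∩ ω ∩ Sᶜ) p mm := by
  obtain ⟨ω', hagree, hω'⟩ := h
  exact int_exists_fence_below_gen hm hk hd htk hagree hω'.1.1.1 hdS hSn

/-- **Outer exclusion** from raw success (from above). [cite: Nolin2008, §4.4 Lemma 15 (proof) (arXiv 0711.4948: Lemma 14)] -/
theorem outer_ring (h : IntRawOKUp m d z k ω) (hk : 1 ≤ k) {s t : Site 2}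
    (hs : z 0 - 17 * k ≤ s 0 ∧ s 0 ≤ z 0 + 17 * k ∧ z 1 - 17 * k ≤ s 1 ∧ s 1 ≤ z 1 + 17 * k)
    (ht : t 0 ≤ z 0 - 31 * k ∨ z 0 + 31 * k ≤ t 0 ∨ t 1 ≤ z 1 - 31 * k ∨ z 1 + 31 * k ≤ t 1) :
    ¬ PathIn triGraph ((↑((intDom m).flip.lower d z) : Set (Site 2))ᶜ ∩ ω) s t := by
  obtain ⟨ω', hagree, hω'⟩ := h
  refine not_pathIn_of_closed_ring hk (L := ↑((intDom m).flip.lower d z)) (fun v hv => hagree v ?_) ?_ subset_rfl hs ht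
  · exact fun h => hv (Finset.mem_coe.2 h)
  · have : ω'ᶜ ∈ triRingAt z k := hω'.1.2
    exact this

/-- **Inner exclusion** from raw success (from above). [cite: Nolin2008, §4.4 Lemma 15 (proof) (arXiv 0711.4948: Lemma 14)] -/
theorem inner_ring (h : IntRawOKUp m d z k ω) (hk : 1 ≤ k) {s t : Site 2}
    (hs : z 0 - 3 * k ≤ s 0 ∧ s 0 ≤ z 0 + 3 * k ∧ z 1 - 3 * k ≤ s 1 ∧ s 1 ≤ z 1 + 3 * k)
    (ht : t 0 ≤ z 0 - 7 * k ∨ z 0 + 7 * k ≤ t 0 ∨ t 1 ≤ z 1 - 7 * k ∨ z 1 + 7 * k ≤ t 1) :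
    ¬ PathIn triGraph ((↑((intDom m).flip.lower d z) : Set (Site 2))ᶜ ∩ ω) s t := by
  obtain ⟨ω', hagree, hω'⟩ := h
  refine not_pathIn_of_closed_innerRing hk (L := ↑((intDom m).flip.lower d z)) (fun v hv => hagree v ?_) ?_ subset_rfl hs ht
  · exact fun h => hv (Finset.mem_coe.2 h)
  · have : ω'ᶜ ∈ triInnerRingAt z k := hω'.2
    exact this

/-- The exclusions for open sets known to avoid `flip.lower d z`. [folklore] -/
theorem not_pathIn_of_subset (h : IntRawOKUp m d z k ω) (hk : 1 ≤ k) {A : Set (Site 2)}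
    (hA : A ⊆ ((↑((intDom m).flip.lower d z) : Set (Site 2))ᶜ ∩ ω)) {s t : Site 2}
    (hs : z 0 - 3 * k ≤ s 0 ∧ s 0 ≤ z 0 + 3 * k ∧ z 1 - 3 * k ≤ s 1 ∧ s 1 ≤ z 1 + 3 * k)
    (ht : t 0 ≤ z 0 - 7 * k ∨ z 0 + 7 * k ≤ t 0 ∨ t 1 ≤ z 1 - 7 * k ∨ z 1 + 7 * k ≤ t 1) :
    ¬ PathIn triGraph A s t := fun hp => h.inner_ring hk hs ht (hp.mono hA)

/-- **Protection from below** from raw success (from above). [cite: Nolin2008, §4.4 Lemma 15 (proof), internal extremities (arXiv 0711.4948: Lemma 14)] -/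
theorem no_escape_below (h : IntRawOKUp m d z k ω) (hk : 1 ≤ k) (hd : (intDom m).flip.IsCrossing d z)
    (hdω : (↑d : Set (Site 2)) ⊆ ω) {q t : Site 2} (hq : q ∈ (intDom m).Bt ∪ (intDom m).Jbelow z)
    (hqin : z 0 - 8 * k ≤ q 0 ∧ q 0 ≤ z 0 + 8 * k ∧ z 1 - 8 * k ≤ q 1 ∧ q 1 ≤ z 1 + 8 * k)
    (ht : t 0 ≤ z 0 - 16 * k ∨ z 0 + 16 * k ≤ t 0 ∨ t 1 ≤ z 1 - 16 * k ∨ z 1 + 16 * k ≤ t 1) :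
    ¬ PathIn triGraph (haSet m ∩ ωᶜ) q t := by
  obtain ⟨ω', hagree, hω'⟩ := h
  intro hpath
  refine int_no_closed_escape_below (k := 8 * k) (by omega) hd hdω hagree hω'.1.1.2 hq ?_ ?_ hpath
  · push_cast; omega
  · push_cast; omega

end IntRawOKUp

/-! ### Raw failure of a term from above -/

/-- **Raw failure of the `u`-th term of the inner exploration from above.** [cite: Nolin2008, §4.4 Lemma 15 (proof), internal extremities (arXiv 0711.4948: Lemma 14)] -/
def IntSeqFailRawUp (m u k₀ K : ℕ) (ω : SiteConfig (Site 2)) : Prop :=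
  ∃ d z, (intDom m).flip.lowestSeq ω u = some (d, z) ∧ ∀ j < K, ¬ IntRawOKUp m d z (trapScale k₀ j) ω

/-- Raw failure from above is `TrapNoRSWL` for the frozen set `flip.lower d z`. [folklore] -/
theorem intNoRSWL_of_failRawUp {m k₀ K : ℕ} {d : Finset (Site 2)} {z : Site 2} {ω : SiteConfig (Site 2)}
    (hfail : ∀ j < K, ¬ IntRawOKUp m d z (trapScale k₀ j) ω) : TrapNoRSWL ((intDom m).flip.lower d z) z k₀ K ω :=
  fun j hj ω' hagree hω' => hfail j hj ⟨ω', hagree, hω'⟩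

/-- **On the complement of raw failure every term from above is raw-good on some scale.** [folklore] -/
theorem exists_intRawOKUp_of_not_fail {m u k₀ K : ℕ} {d : Finset (Site 2)} {z : Site 2} {ω : SiteConfig (Site 2)}
    (h : ¬ IntSeqFailRawUp m u k₀ K ω) (hu : (intDom m).flip.lowestSeq ω u = some (d, z)) :
    ∃ j < K, IntRawOKUp m d z (trapScale k₀ j) ω := by
  by_contra hno
  push Not at hno
  exact h ⟨d, z, hu, fun j hj hok => hno j hj hok⟩

end Literature.Probability.Percolation
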